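import Summits.CriticalPhenomena.SAWScalingLimit.Theorems.SAWTotalPositivityCriticalBubbleBoundKestenStripDetour
import Summits.CriticalPhenomena.SAWScalingLimit.Theorems.SAWTotalPositivityCriticalBubbleBoundKestenStripBlocks
import Summits.CriticalPhenomena.SAWScalingLimit.Theorems.SAWTotalPositivityCriticalBubbleBoundKestenStripGap
import Summits.CriticalPhenomena.SAWScalingLimit.Theorems.SAWTotalPositivityCriticalBubbleBoundKestenStripPinned
import Summits.CriticalPhenomena.SAWScalingLimit.Theorems.SAWTotalPositivityCriticalBubbleBoundKestenCutExponents
import Summits.CriticalPhenomena.SAWScalingLimit.Theorems.SAWTotalPositivityCriticalBubbleBoundKestenColumnMassLeOne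

/-!
# Line `kesten-product-renewal-dictionary` for the crux `SAWTotalPositivity.CriticalBubbleBound`
(stmt-CriticalPhenomena-7117): the strip gap `μ(strip) < μ(ℤ²)` and the FLOOR under stub B1 —
every pinned length-weighted critical bridge mass `L(v)` is finite, uniformly along each column, and every
term `F(h)`, `M₂(h)` of the line's two series is finite

Assembly of the strip-gap programme (lead c3; the four inputs landed as their own files):

* `Strip.detour_count` (T1, `…KestenStripDetour.lean`): boundary detours into the free column beyond a
  column bounding the walk — `#{ω : ≥ m same-parity vertical steps in column R ⊇-bounding} · C(m,j) ≤ c_{n+2j}`;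
* `Strip.badBlocks_le` (T2, `…KestenStripBlocks.lean`): a walk with columns in `[R-(w+1), R]` has at most
  `2k + 4` length-`M` blocks that are not `w`-narrow, `k` = number of vertical steps inside column `R`;
* `Strip.strip_gap_of` (T3, `…KestenStripGap.lean`): from T1 and T2, by induction on the width with the block
  decomposition of Madras–Slade Lemma 7.2.5 (`Zd.card_few_badBlocks_le`), for every `w` the `w`-narrow
  `n`-step self-avoiding walks from `0` (all first coordinates within `w` of each other) number `≤ C ρⁿ` with
  `ρ < μ(ℤ²)` — the classical strict inequality `μ(strip of width w) < μ` (Whittington 1983; Hammersley–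
  Whittington 1985; usually quoted from Kesten's pattern theorem, here pattern-theorem-free);
* `Strip.pinnedLengthMass_lt_top_of_gap` (T4, `…KestenStripPinned.lean`): the gap makes `L(v) < ∞`.

Here: `strip_gap` (T3 ∘ (T1, T2)), `pinnedLengthMass_lt_top` (`∀ v, L(v) < ∞`), the column-uniform bound
`exists_pinnedLengthMass_le_of_column` (`∀ h, ∃ B < ∞, ∀ v, v₀ = h → L(v) ≤ B` — the shape of the open stub
`Kesten.PinnedLengthMassBound a`, which asks in addition for `B = C (h+1)^a`), and the finiteness of every term of
the line's series: `freePairMass_lt_top` (`F(h) < ∞`, through the landed Fubini step `Cut.freePairMass_le` and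
Kesten's bound `Cut.columnMass_le_one`) and `disjointPairMass_lt_top` (`M₂(h) ≤ F(h)`); finally `spanLengthMass_lt_top`
(`Λ_h = Σ_{span W = h} |W| x_c^{|W|} = x_c B_h'(x_c) < ∞`: the span-`h` bridge generating function, whose value at `x_c` is
Kesten's `u_h ≤ 1`, has radius of convergence `> x_c`).

What this does NOT give: any growth rate in `h` (the open stub B1 `PinnedLengthMassBound (1/5)` asks for
`sup_{v₀ = h} L(v) ≤ C (h+1)^{1/5}`; the constant `B(h)` produced here comes from `μ(strip_h) < μ` and is not
even known to be polynomial in `h`), nor anything on the two-walk stub C `DisjointnessGain (5/4)`.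

Sources: N. Madras, G. Slade, *The Self-Avoiding Walk* (1993), §4.2 (objects), Lemma 7.2.5 (blocks), §8.1
(walks in strips); S. G. Whittington, *J. Stat. Phys.* 30 (1983) 449–456; J. M. Hammersley, S. G. Whittington,
*J. Phys. A* 18 (1985) 101–111 (strict monotonicity of connective constants of strips).
-/

noncomputable section

open Literature.Probability.LatticeModels
open Literature.Probability.RandomPlanarGeometry Literature.Probability.RandomPlanarGeometry.SAW
open scoped ENNReal NNReal BigOperators

namespace Summit.CriticalPhenomena.SAWScalingLimit.Theorems.CriticalBubbleBound.Kesten.Strip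

/-! ## The strip gap -/

/-- **The strip gap `μ(strip of width w) < μ(ℤ²)`, counting form.** For every width `w` there are `ρ < μ(ℤ²)`
and `C` such that the `n`-step self-avoiding walks from `0` all of whose first coordinates lie within `w` of each
other number at most `C ρⁿ`. Assembly of the programme: `strip_gap_of` (induction on `w`, blocks) applied to
`detour_count` (Case 1: boundary detours) and `badBlocks_le` (Case 2: few wide blocks).
[cite: MadrasSlade1993, Lemma 7.2.5; §8.1] -/
theorem strip_gap : ∀ w : ℕ, ∃ ρ : ℝ, 0 ≤ ρ ∧ ρ < Zd.connectiveConstant 2 ∧ ∃ C : ℝ, ∀ n : ℕ, (((Zd.saws 2 n).filter (fun ω => ∀ i ≤ n, ∀ i' ≤ n, ω i 0 ≤ ω i' 0 + (w : ℤ))).card : ℝ) ≤ C * ρ ^ n :=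
  strip_gap_of detour_count badBlocks_le

/-! ## The floor under stub B1: `L(v) < ∞`, uniformly along each column -/

/-- **`L(v) < ∞` for every site `v`**: the length-weighted critical mass of the bridges of `ℤ²` pinned at `v`,
`Σ_{tip W = v} |W| x_c^{|W|}`, is finite (the first theorem on the side of the line's open one-walk stub B1
`Kesten.PinnedLengthMassBound`; before it not even finiteness was recorded). From the strip gap: a bridge with
tip `v` is `v₀`-narrow, so `L(v) ≤ Σ_n C n (ρ x_c)ⁿ` with `ρ x_c < 1`. [cite: MadrasSlade1993, §4.2; §8.1] -/
theorem pinnedLengthMass_lt_top : ∀ v : Site 2, pinnedLengthMass v < ⊤ :=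
  pinnedLengthMass_lt_top_of_gap strip_gap

/-- **Column-uniform bound**: for every column `h` there is a FINITE `B` with `L(v) ≤ B` for all sites `v` of
column `h` (the bound of `pinnedLengthMass_lt_top` depends on `v` only through `v₀`). This is the shape of the
open stub `PinnedLengthMassBound a` without its growth rate `B = C (h+1)^a`. [cite: MadrasSlade1993, §4.2; §8.1] -/
theorem exists_pinnedLengthMass_le_of_column :
    ∀ h : ℕ, ∃ B : ℝ≥0∞, B < ⊤ ∧ ∀ v : Site 2, v 0 = (h : ℤ) → pinnedLengthMass v ≤ B := by
  intro h
  obtain ⟨ρ, hρ0, hρμ, C, hC⟩ := strip_gap h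
  -- constants: `0 < x_c`, `0 ≤ ρ x_c < 1`
  have hx : 0 < criticalFugacity := criticalFugacity_pos_lt_one'.1
  have hρμ' : ρ < connectiveConstant := by
    rw [Zd.connectiveConstant_two] at hρμ
    exact hρμ
  have hμpos : 0 < connectiveConstant := hρ0.trans_lt hρμ'
  have hxc : criticalFugacity = connectiveConstant⁻¹ := rfl
  have hr0 : 0 ≤ ρ * criticalFugacity := mul_nonneg hρ0 hx.le
  have hr1 : ρ * criticalFugacity < 1 := by
    rw [hxc]
    calc ρ * connectiveConstant⁻¹ < connectiveConstant * connectiveConstant⁻¹ :=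
          mul_lt_mul_of_pos_right hρμ' (inv_pos.2 hμpos)
      _ = 1 := mul_inv_cancel₀ hμpos.ne'
  have hnorm : ‖ρ * criticalFugacity‖ < 1 := by
    rw [Real.norm_of_nonneg hr0]
    exact hr1
  -- WLOG `0 ≤ C`
  have hC'0 : (0 : ℝ) ≤ max C 0 := le_max_right _ _
  have hC'n := fun n : ℕ =>
    (hC n).trans (mul_le_mul_of_nonneg_right (le_max_left C 0) (pow_nonneg hρ0 n))
  -- the real majorant `n ↦ C' n (ρ x_c)ⁿ` is summable
  have hg0 : ∀ n : ℕ, 0 ≤ max C 0 * ((n : ℝ) * (ρ * criticalFugacity) ^ n) := fun n =>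
    mul_nonneg hC'0 (mul_nonneg n.cast_nonneg (pow_nonneg hr0 n))
  have hgs : Summable (fun n : ℕ => max C 0 * ((n : ℝ) * (ρ * criticalFugacity) ^ n)) :=
    (hasSum_coe_mul_geometric_of_norm_lt_one hnorm).summable.mul_left (max C 0)
  refine ⟨∑' n : ℕ, ENNReal.ofReal (max C 0 * ((n : ℝ) * (ρ * criticalFugacity) ^ n)), ?_, ?_⟩
  · rw [← ENNReal.ofReal_tsum_of_nonneg hg0 hgs]
    exact ENNReal.ofReal_lt_top
  · intro v hv
    have hvh : (v 0).toNat = h := by rw [hv, Int.toNat_natCast]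
    unfold pinnedLengthMass
    rw [ENNReal.tsum_sigma']
    refine ENNReal.tsum_le_tsum fun n => ?_
    rw [tsum_fintype]
    show ∑ b : ↥(Zd.bridges 2 n),
        (if Bridge.tip ⟨n, b⟩ = v then (n : ℝ≥0∞) * ENNReal.ofReal (criticalFugacity ^ n) else 0) ≤ _
    have hB : (((Zd.saws 2 n).filter
        (fun ω => ∀ i ≤ n, ∀ i' ≤ n, ω i 0 ≤ ω i' 0 + (((v 0).toNat : ℕ) : ℤ))).card : ℝ) ≤
        max C 0 * ρ ^ n := by
      rw [hvh]
      exact hC'n n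
    refine (sum_slice_le v n hB).trans (le_of_eq ?_)
    rw [← ENNReal.ofReal_natCast n, ← ENNReal.ofReal_mul n.cast_nonneg,
      ← ENNReal.ofReal_mul (mul_nonneg hC'0 (pow_nonneg hρ0 n)), mul_pow]
    congr 1
    ring

/-! ## Every term of the line's two series is finite -/

/-- **`F(h) < ∞`**: the free (Kesten ⊗ Kesten) length-weighted mass of bridge pairs meeting at a common apex in
column `h` is finite — Fubini (`Cut.freePairMass_le`: `F(h) ≤ 2 u_h sup_{v₀ = h} L(v)`), Kesten's bound
`u_h ≤ 1` (`Cut.columnMass_le_one`) and the column-uniform bound on `L`. [cite: MadrasSlade1993, §4.2] -/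
theorem freePairMass_lt_top : ∀ h : ℕ, freePairMass h < ⊤ := by
  intro h
  obtain ⟨B, hB, hle⟩ := exists_pinnedLengthMass_le_of_column h
  have h1 : freePairMass h ≤ 2 * (columnMass h * B) := Cut.freePairMass_le h B hle
  have h2 : columnMass h * B ≤ 1 * B := mul_le_mul' (Cut.columnMass_le_one h) le_rfl
  refine lt_of_le_of_lt (h1.trans (mul_le_mul' le_rfl h2)) ?_
  rw [one_mul]
  exact ENNReal.mul_lt_top (by simp) hB

/-- **`M₂(h) < ∞`**: the disjoint (apex-only) pair mass of column `h` — the `h`-th term of the series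
`Σ_h M₂(h)` whose finiteness IS the crux on this line (`Cut.bubble_le_twoBridge`) — is finite, since
`M₂(h) ≤ F(h)` (`disjointPairMass_le_freePairMass`). The crux asks for summability in `h`, which stays open.
[cite: MadrasSlade1993, §4.2; p. 37] -/
theorem disjointPairMass_lt_top : ∀ h : ℕ, disjointPairMass h < ⊤ := fun h =>
  lt_of_le_of_lt (disjointPairMass_le_freePairMass h) (freePairMass_lt_top h)

/-! ## The length-weighted renewal density `Λ_h = Σ_{span W = h} |W| x_c^{|W|} = x_c B_h'(x_c)` is finite -/

/-- The `n`-step bridges of span `h` inject (by their vertex function) into the `h`-narrow `n`-step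
self-avoiding walks: all their first coordinates lie in `[0, h]`. [cite: MadrasSlade1993, Definition 1.2.4] -/
theorem card_filter_span_le (h n : ℕ) :
    (Finset.univ.filter (fun b : ↥(Zd.bridges 2 n) => Bridge.span ⟨n, b⟩ = (h : ℤ))).card ≤
      ((Zd.saws 2 n).filter (fun ω => ∀ i ≤ n, ∀ i' ≤ n, ω i 0 ≤ ω i' 0 + (h : ℤ))).card := by
  refine Finset.card_le_card_of_injOn (fun b => b.1) (fun b hb => ?_) Subtype.val_injective.injOn
  have hbv : b.1 n 0 = (h : ℤ) := (Finset.mem_filter.1 hb).2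
  obtain ⟨hs, -⟩ := Zd.mem_bridges.1 b.2
  refine Finset.mem_coe.2 (Finset.mem_filter.2 ⟨hs, fun i hi i' hi' => ?_⟩)
  have h1 := (column_nonneg_le_of_mem_bridges b.2 hi).2
  have h2 := (column_nonneg_le_of_mem_bridges b.2 hi').1
  linarith

/-- **`Λ_h < ∞`**: the length-weighted critical mass of ALL bridges of span `h`,
`Σ_{span W = h} |W| x_c^{|W|}` (`= x_c · B_h'(x_c)` for the span-`h` bridge generating function `B_h`, whose value
`B_h(x_c) = u_h ≤ 1` is Kesten's bound), is finite — equivalently `B_h` has radius of convergence `> x_c`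
(`μ(strip_h) < μ`). [cite: MadrasSlade1993, §4.2; §8.1] -/
theorem spanLengthMass_lt_top :
    ∀ h : ℕ, (∑' W : Bridge, if W.span = (h : ℤ) then (W.len : ℝ≥0∞) * W.mass else 0) < ⊤ := by
  intro h
  obtain ⟨ρ, hρ0, hρμ, C, hC⟩ := strip_gap h
  have hx : 0 < criticalFugacity := criticalFugacity_pos_lt_one'.1
  have hρμ' : ρ < connectiveConstant := by
    rw [Zd.connectiveConstant_two] at hρμ
    exact hρμ
  have hμpos : 0 < connectiveConstant := hρ0.trans_lt hρμ'
  have hxc : criticalFugacity = connectiveConstant⁻¹ := rfl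
  have hr0 : 0 ≤ ρ * criticalFugacity := mul_nonneg hρ0 hx.le
  have hr1 : ρ * criticalFugacity < 1 := by
    rw [hxc]
    calc ρ * connectiveConstant⁻¹ < connectiveConstant * connectiveConstant⁻¹ :=
          mul_lt_mul_of_pos_right hρμ' (inv_pos.2 hμpos)
      _ = 1 := mul_inv_cancel₀ hμpos.ne'
  have hnorm : ‖ρ * criticalFugacity‖ < 1 := by
    rw [Real.norm_of_nonneg hr0]
    exact hr1
  have hC'0 : (0 : ℝ) ≤ max C 0 := le_max_right _ _
  have hC'n := fun n : ℕ =>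
    (hC n).trans (mul_le_mul_of_nonneg_right (le_max_left C 0) (pow_nonneg hρ0 n))
  have hg0 : ∀ n : ℕ, 0 ≤ max C 0 * ((n : ℝ) * (ρ * criticalFugacity) ^ n) := fun n =>
    mul_nonneg hC'0 (mul_nonneg n.cast_nonneg (pow_nonneg hr0 n))
  have hgs : Summable (fun n : ℕ => max C 0 * ((n : ℝ) * (ρ * criticalFugacity) ^ n)) :=
    (hasSum_coe_mul_geometric_of_norm_lt_one hnorm).summable.mul_left (max C 0)
  have key : (∑' W : Bridge, if W.span = (h : ℤ) then (W.len : ℝ≥0∞) * W.mass else 0) ≤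
      ∑' n : ℕ, ENNReal.ofReal (max C 0 * ((n : ℝ) * (ρ * criticalFugacity) ^ n)) := by
    rw [ENNReal.tsum_sigma']
    refine ENNReal.tsum_le_tsum fun n => ?_
    rw [tsum_fintype]
    show ∑ b : ↥(Zd.bridges 2 n),
        (if Bridge.span ⟨n, b⟩ = (h : ℤ) then (n : ℝ≥0∞) * ENNReal.ofReal (criticalFugacity ^ n) else 0) ≤ _
    rw [← Finset.sum_filter, Finset.sum_const, nsmul_eq_mul]
    calc ((Finset.univ.filter (fun b : ↥(Zd.bridges 2 n) => Bridge.span ⟨n, b⟩ = (h : ℤ))).card : ℝ≥0∞) *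
          ((n : ℝ≥0∞) * ENNReal.ofReal (criticalFugacity ^ n))
        ≤ ENNReal.ofReal (max C 0 * ρ ^ n) * ((n : ℝ≥0∞) * ENNReal.ofReal (criticalFugacity ^ n)) := by
          gcongr
          calc ((Finset.univ.filter (fun b : ↥(Zd.bridges 2 n) => Bridge.span ⟨n, b⟩ = (h : ℤ))).card : ℝ≥0∞)
              ≤ (((Zd.saws 2 n).filter (fun ω => ∀ i ≤ n, ∀ i' ≤ n, ω i 0 ≤ ω i' 0 + (h : ℤ))).card : ℝ≥0∞) := by
                exact_mod_cast card_filter_span_le h n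
            _ ≤ ENNReal.ofReal (max C 0 * ρ ^ n) := by
                rw [← ENNReal.ofReal_natCast]
                exact ENNReal.ofReal_le_ofReal (hC'n n)
      _ = ENNReal.ofReal (max C 0 * ((n : ℝ) * (ρ * criticalFugacity) ^ n)) := by
          rw [← ENNReal.ofReal_natCast n, ← ENNReal.ofReal_mul n.cast_nonneg,
            ← ENNReal.ofReal_mul (mul_nonneg hC'0 (pow_nonneg hρ0 n)), mul_pow]
          congr 1
          ring
  have hfin : ∑' n : ℕ, ENNReal.ofReal (max C 0 * ((n : ℝ) * (ρ * criticalFugacity) ^ n)) < ⊤ := by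
    rw [← ENNReal.ofReal_tsum_of_nonneg hg0 hgs]
    exact ENNReal.ofReal_lt_top
  exact lt_of_le_of_lt key hfin

end Summit.CriticalPhenomena.SAWScalingLimit.Theorems.CriticalBubbleBound.Kesten.Strip

end
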